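import Mathlib
import Summits.BirchSwinnertonDyer.BirchSwinnertonDyer.Theorems.ResidualThetaTransportAtTwoSignedMuSeedAtTwoPlusNonsquareDescentTowerNorms
import Summits.BirchSwinnertonDyer.BirchSwinnertonDyer.Theorems.ResidualThetaTransportAtTwoSignedMuSeedAtTwoPlusNonsquareDescentCertificate
import HarnessLib

/-!
# Non-square descent — STUB S3 IN THE CARD'S NOTATION: the `2`-tower over `k⟦T⟧` in characteristic `2` with norms `N_{n+1,n} = 1 + γ^{2ⁿ}`
# (line card `nonsquare-descent`) for the seed crux `SignedMuSeedAtTwoPlus` stmt-BirchSwinnertonDyer-21438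
# (parent Kμ⁺ `SignedMuVanishingAtTwoPlus` stmt-BirchSwinnertonDyer-20689, route ResidualThetaTransportAtTwo)

Cell `bsd-wall`, width seat `bsd-wall-rtt-p4-w2` g17 (`--supports`, closes nothing).  THEOREMS ONLY; BSD is not proved by this; nothing
arithmetic is asserted.  A thin wrapper putting the composed S3 statement (`Theorems/…NonsquareDescentCertificate.lean`, exponent ladder `d`,
scalar `x`) into the literal shape of `Cruxes/SignedMuSeedAtTwoPlus/Lines/nonsquare-descent.md` S3 (b): over `k⟦T⟧` with `k` of
characteristic `2` (`k = 𝔽₄`), `γ = 1 + T`, the norm of the quadratic step `M_{n+1}/M_n` is `N_{G_{n+1,n}} = 1 + γ^{2ⁿ}`, which acts as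
`T^{2ⁿ}` (`one_add_one_add_pow_eq_pow_of_charTwo`, `Theorems/…NonsquareDescentTowerNorms.lean`), and the ladder `2ⁿ` is unbounded.

* `charP_powerSeries` — `k⟦T⟧` has characteristic `p` when `k` has; `exists_le_two_pow` — the ladder `2ⁿ` is unbounded.
* `norm_incl_eq_X_pow_smul_of_charTwo` — `ι n (N n v) = (1 + (1+T)^{2ⁿ}) • v` ⇒ `ι n (N n v) = T^{2ⁿ} • v` (hypothesis `hN` of the engine).
* **`eq_zero_or_nonTorsion_of_proj_charTwo`**, **`isTorsion_quotient_iff_exists_proj_ne_zero_charTwo`** — «`ū_∞` is `0` or free» and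
  «`μ(Q') = 0 ⟺ ∃ m GNS(m)`» (module form) with the norm hypothesis stated as `N_{n+1,n} = 1 + γ^{2ⁿ}`.

[folklore]
-/

set_option autoImplicit false
-- the Theorems namespace of this sub repeats the summit name by design (D-0017 nested layout)
set_option linter.dupNamespace false

namespace Summit.BirchSwinnertonDyer.BirchSwinnertonDyer.Theorems.SignedMuAtTwo.NonsquareDescent

section CharTwoTower

/-- `k⟦T⟧` has the characteristic of `k`. [folklore] -/
theorem charP_powerSeries (k : Type*) [CommRing k] (p : ℕ) [CharP k p] : CharP (PowerSeries k) p :=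
  charP_of_injective_algebraMap (R := k) (A := PowerSeries k) PowerSeries.C_injective p

/-- The ladder `2ⁿ` is unbounded. [folklore] -/
theorem exists_le_two_pow (a : ℕ) : ∃ n : ℕ, a ≤ 2 ^ n := ⟨a, Nat.lt_two_pow_self.le⟩

variable {k : Type*} [Field k] [CharP k 2]
variable (W : ℕ → Type*) [∀ n, AddCommGroup (W n)] [∀ n, Module (PowerSeries k) (W n)]

/-- **`N_{n+1,n} = 1 + γ^{2ⁿ}` acts as `T^{2ⁿ}`** on modules over `k⟦T⟧`, `char k = 2`: the engine hypothesis `hN` from the norm form.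
[folklore] -/
theorem norm_incl_eq_X_pow_smul_of_charTwo
    (ι : ∀ n, W n →ₗ[PowerSeries k] W (n + 1)) (N : ∀ n, W (n + 1) →ₗ[PowerSeries k] W n)
    (hN : ∀ n (v : W (n + 1)), ι n (N n v) = (1 + (1 + (PowerSeries.X : PowerSeries k)) ^ 2 ^ n) • v)
    (n : ℕ) (v : W (n + 1)) :
    ι n (N n v) = (PowerSeries.X : PowerSeries k) ^ (2 ^ n) • v := by
  haveI : CharP (PowerSeries k) 2 := charP_powerSeries k 2
  rw [hN, one_add_one_add_pow_eq_pow_of_charTwo]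

/-- **«`ū_∞` is either `0` or free»** in the card's notation (characteristic `2`, norms `1 + γ^{2ⁿ}`). [folklore] -/
theorem eq_zero_or_nonTorsion_of_proj_charTwo
    (ι : ∀ n, W n →ₗ[PowerSeries k] W (n + 1)) (hι : ∀ n, Function.Injective (ι n))
    (N : ∀ n, W (n + 1) →ₗ[PowerSeries k] W n)
    (hN : ∀ n (v : W (n + 1)), ι n (N n v) = (1 + (1 + (PowerSeries.X : PowerSeries k)) ^ 2 ^ n) • v)
    (u : ∀ n, W n) (hu : ∀ n, N n (u (n + 1)) = u n)
    {Winf : Type*} [AddCommGroup Winf] [Module (PowerSeries k) Winf] (π : ∀ n, Winf →ₗ[PowerSeries k] W n)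
    (hsep : ∀ q : Winf, (∀ n, π n q = 0) → q = 0)
    (uinf : Winf) (hπ : ∀ n, π n uinf = u n) :
    uinf = 0 ∨ ∀ f : PowerSeries k, f ≠ 0 → f • uinf ≠ 0 :=
  eq_zero_or_nonTorsion_of_proj W (fun n => 2 ^ n) exists_le_two_pow ι hι N
    (norm_incl_eq_X_pow_smul_of_charTwo W ι N hN) u hu π hsep uinf hπ

/-- **«`μ(Q') = 0 ⟺ ∃ m GNS(m)`» (module form) in the card's notation**: tower of `k⟦T⟧`-modules `W n = 𝓔_n^χ/2` (`char k = 2`) with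
injective inclusions (input (a)), norms `N n` with `ι n ∘ N n = (1 + γ^{2ⁿ}) •` (input (b)), a norm-coherent family `ū_n`, and
`Winf = Ē^χ/2` of rank `≤ 1` with a non-torsion element and jointly injective projections carrying `ū_∞` to `ū_n`: `Winf ⧸ ⟨ū_∞⟩` is
torsion iff some `ū_m ≠ 0`. [folklore] -/
theorem isTorsion_quotient_iff_exists_proj_ne_zero_charTwo
    (ι : ∀ n, W n →ₗ[PowerSeries k] W (n + 1)) (hι : ∀ n, Function.Injective (ι n))
    (N : ∀ n, W (n + 1) →ₗ[PowerSeries k] W n)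
    (hN : ∀ n (v : W (n + 1)), ι n (N n v) = (1 + (1 + (PowerSeries.X : PowerSeries k)) ^ 2 ^ n) • v)
    (u : ∀ n, W n) (hu : ∀ n, N n (u (n + 1)) = u n)
    {Winf : Type*} [AddCommGroup Winf] [Module (PowerSeries k) Winf] (π : ∀ n, Winf →ₗ[PowerSeries k] W n)
    (hsep : ∀ q : Winf, (∀ n, π n q = 0) → q = 0)
    (uinf : Winf) (hπ : ∀ n, π n uinf = u n)
    (hrank : ∀ v w : Winf, ∃ a b : PowerSeries k, (a ≠ 0 ∨ b ≠ 0) ∧ a • v + b • w = 0)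
    {w : Winf} (hw : ∀ b : PowerSeries k, b ≠ 0 → b • w ≠ 0) :
    (∀ q : Winf ⧸ Submodule.span (PowerSeries k) {uinf}, ∃ b : PowerSeries k, b ≠ 0 ∧ b • q = 0)
      ↔ ∃ m, u m ≠ 0 :=
  isTorsion_quotient_iff_exists_proj_ne_zero W (fun n => 2 ^ n) exists_le_two_pow ι hι N
    (norm_incl_eq_X_pow_smul_of_charTwo W ι N hN) u hu π hsep uinf hπ hrank hw

end CharTwoTower

end Summit.BirchSwinnertonDyer.BirchSwinnertonDyer.Theorems.SignedMuAtTwo.NonsquareDescent
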